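import Summits.CriticalPhenomena.PercolationContinuityZ3.Theorems.PercNearOneGluingNoHeavyLowerTailSahiSlotTensorCone

/-!
# The coefficientwise Harris slack on the slot cube `[3]^d` is a nonnegative combination of products of PARALLEL cut edges,
# in every dimension (explicit integer certificate) — the free-block ingredient `PP(H_n)` of the cylinder-lifting identity

Support file of the one-cut programme (crux `NoHeavyLowerTail`, stmt-CriticalPhenomena-4575; cell `prim-masterthm`, seat P3, gen 22;
`run/shared/lean/prim/prim-masterthm/prim-masterthm-p3/HIERARCHY.md` §30).  Pure proofs + two bookkeeping definitions (`succ3`, `bump`,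
`harrisSlack`), standard axioms.

THE FORM.  On the order-3 slot cube `Q = [3]^d` call `x, x'` OPPOSITE if they differ in every coordinate (each point has `2^d` opposites).  The
coefficientwise Harris slack is the bilinear form
  `harrisSlack d y z = Σ_x y(x) · (2^d · z(x) − Σ_{x' opposite x} z(x'))`;
on indicators of up-sets `X, V` it is `2^d·#(X ∩ V) − N(X;V) ≥ 0` (prim-sahi's `H_d`, positivity = `SahiGridPattern.sum_ind_totDist_le`, the
coefficientwise Harris / order-2 pattern inequality).  It is the free-block term of the cell form of a cylinder
(`SahiGridPattern.sStarD_cylSet_eq`: `T2 − N2`), and "`H_n ∈ C⊗C` for every `n`" is the ingredient that turns prim-sahi's `(†)_k(U)` certificates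
into pivotal-pair certificates of `U × [3]^n` in EVERY dimension (memo FROM-prim-masterthm-p3-g21 §9 (P2); LP-checked there for `n ≤ 4` only).

THIS FILE: **`harrisSlack_eq_sum_coverPairs`** — for every `d` there is an explicit finite family of PARALLEL cut-edge pairs
`((ω_t, a_t), (ω'_t, a_t))` with positive INTEGER weights `c_t` such that, for ALL `y, z : [3]^d → ℝ`,
  `harrisSlack d y z = Σ_t c_t · (y(ω_t + e_{a_t}) − y(ω_t)) · (z(ω'_t + e_{a_t}) − z(ω'_t))`.
Recursion on `d` (`2^{d+1} I − Opp_{d+1} = (2^d I − Opp_d) ⊗ 2I₃ + Opp_d ⊗ (3I₃ − J₃)`): three same-layer copies of the `d`-certificate with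
doubled weights, plus, for every ordered opposite pair `(p, q)` of `[3]^d`, the vertical cut edges over `p` and `q` paired with the weights
`3I₃ − J₃ = 2·v₁⊗v₁ + v₁⊗v₂ + v₂⊗v₁ + 2·v₂⊗v₂` (`v₁ = x₁ − x₀`, `v₂ = x₂ − x₁` on the chain `[3]`).  Packaged with the tree's literals:
**`harrisSlack_eq_sum_litPairs`** (`SahiSlot.Lit d 3`, nonnegative coefficients), and `harrisSlack_setInd_nonneg` (sign on up-sets).  The `[2]^d` analogue (the order-2 slot functional itself) is
`…SahiSlotTensorConeOrderTwo`.
HONEST LABEL: an order-2 certificate identity; it proves no open cell.  Its use: with it, every EXACT `(†)_k(U)` certificate of prim-sahi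
(census W49: all 226 classes of `[3]^3`) yields pivotal-pair certificates of `U × [3]^n` for all `n` by (P2) — not formalised here. [this work]
-/

noncomputable section

namespace Summit.CriticalPhenomena.PercolationContinuityZ3.Theorems

open Finset Function

namespace SahiSlot

section HarrisSlack

variable {d : ℕ}

/-- Successor on the chain `[3]`, saturating at the top. [this work] -/
def succ3 (v : Fin 3) : Fin 3 := if h : (v : ℕ) + 1 < 3 then ⟨(v : ℕ) + 1, h⟩ else v

/-- Raise coordinate `a` of a point of `[3]^d` by one (saturating). [this work] -/
def bump (p : Q d 3) (a : Fin d) : Q d 3 := update p a (succ3 (p a))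

/-- The coefficientwise Harris slack form on `[3]^d`: `2^d Σ_x y(x)z(x) − Σ_{x, x' opposite} y(x) z(x')`. [this work] -/
def harrisSlack (d : ℕ) (y z : Q d 3 → ℝ) : ℝ :=
  (2:ℝ) ^ d * (∑ x, y x * z x) - ∑ x, ∑ x', if (∀ a, x a ≠ x' a) then y x * z x' else 0

/-- A genuine cut edge evaluates as the bump difference. [this work] -/
theorem Lit.eval_cover_eq_bump (p : Q d 3) (a : Fin d) (hp : (p a : ℕ) + 1 < 3) (x : Q d 3 → ℝ) :
    (Lit.cover p a : Lit d 3).eval x = x (bump p a) - x p := by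
  show (if h : (p a : ℕ) + 1 < 3 then x (update p a ⟨(p a : ℕ) + 1, h⟩) - x p else 0) = x (bump p a) - x p
  rw [dif_pos hp]
  unfold bump succ3
  rw [dif_pos hp]

/-- Splitting a sum over `[3]^{d+1}` along the last coordinate. [this work] -/
theorem sum_cube3_succ (f : Q (d + 1) 3 → ℝ) : ∑ q, f q = ∑ j : Fin 3, ∑ p : Q d 3, f (Fin.snoc p j) := by
  rw [← (Fin.snocEquiv fun _ : Fin (d + 1) => Fin 3).sum_comp, Fintype.sum_prod_type]
  rfl

/-- Splitting a sum over `[3]^{d+1}`, base point outermost. [this work] -/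
theorem sum_cube3_succ' (f : Q (d + 1) 3 → ℝ) : ∑ q, f q = ∑ p : Q d 3, ∑ j : Fin 3, f (Fin.snoc p j) := by
  rw [sum_cube3_succ, Finset.sum_comm]

/-- Opposite `snoc` points: opposite initial parts and different last values. [this work] -/
theorem opp_snoc_iff (p q : Q d 3) (i j : Fin 3) :
    (∀ a, (Fin.snoc p i : Q (d + 1) 3) a ≠ (Fin.snoc q j : Q (d + 1) 3) a) ↔ ((∀ a, p a ≠ q a) ∧ i ≠ j) := by
  constructor
  · intro h
    refine ⟨fun a => ?_, ?_⟩
    · have := h (Fin.castSucc a); simpa only [Fin.snoc_castSucc] using this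
    · have := h (Fin.last d); simpa only [Fin.snoc_last] using this
  · rintro ⟨h1, h2⟩ a
    refine Fin.lastCases ?_ (fun b => ?_) a
    · simpa only [Fin.snoc_last] using h2
    · simpa only [Fin.snoc_castSucc] using h1 b

/-- Bumping a horizontal coordinate commutes with `snoc`. [this work] -/
theorem bump_snoc_castSucc (p : Q d 3) (j : Fin 3) (a : Fin d) :
    bump (Fin.snoc p j : Q (d + 1) 3) (Fin.castSucc a) = Fin.snoc (bump p a) j := by
  unfold bump
  rw [Fin.snoc_castSucc, ← Fin.snoc_update]

/-- Bumping the last coordinate. [this work] -/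
theorem bump_snoc_last (p : Q d 3) (j : Fin 3) :
    bump (Fin.snoc p j : Q (d + 1) 3) (Fin.last d) = Fin.snoc p (succ3 j) := by
  unfold bump
  rw [Fin.snoc_last, Fin.update_snoc_last]

/-- The one-dimensional identity behind the vertical pairs: `Yᵀ(3I − J)Z = 2v₁v₁' + v₁v₂' + v₂v₁' + 2v₂v₂'`. [this work] -/
theorem threeI_sub_J_eq (Y Z : Fin 3 → ℝ) :
    (∑ i : Fin 3, ∑ j : Fin 3, if i ≠ j then Y i * Z j else 0) =
      2 * (∑ i, Y i * Z i) - (2 * ((Y 1 - Y 0) * (Z 1 - Z 0)) + (Y 1 - Y 0) * (Z 2 - Z 1) + (Y 2 - Y 1) * (Z 1 - Z 0)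
        + 2 * ((Y 2 - Y 1) * (Z 2 - Z 1))) := by
  simp only [Fin.sum_univ_three]
  have h01 : ((0 : Fin 3) ≠ 1) := by decide
  have h02 : ((0 : Fin 3) ≠ 2) := by decide
  have h10 : ((1 : Fin 3) ≠ 0) := by decide
  have h12 : ((1 : Fin 3) ≠ 2) := by decide
  have h20 : ((2 : Fin 3) ≠ 0) := by decide
  have h21 : ((2 : Fin 3) ≠ 1) := by decide
  simp only [ne_eq, not_true_eq_false, if_false, h01, h02, h10, h12, h20, h21, not_false_eq_true, if_true]
  ring

/-- **The explicit parallel-cut-edge certificate of the Harris slack on `[3]^d`, every dimension** (positive integer weights; pairs of cut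
edges in a COMMON direction). [this work] -/
theorem harrisSlack_eq_sum_coverPairs (d : ℕ) :
    ∃ (ι : Type) (_ : Fintype ι) (c : ι → ℝ) (ω ω' : ι → Q d 3) (a : ι → Fin d),
      (∀ t, 0 ≤ c t) ∧ (∀ t, ((ω t (a t) : ℕ)) + 1 < 3) ∧ (∀ t, ((ω' t (a t) : ℕ)) + 1 < 3) ∧
      ∀ y z : Q d 3 → ℝ, harrisSlack d y z =
        ∑ t, c t * ((y (bump (ω t) (a t)) - y (ω t)) * (z (bump (ω' t) (a t)) - z (ω' t))) := by
  induction d with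
  | zero =>
    refine ⟨Empty, inferInstance, Empty.elim, Empty.elim, Empty.elim, Empty.elim, fun t => t.elim, fun t => t.elim, fun t => t.elim,
      fun y z => ?_⟩
    have h : ∀ x x' : Q 0 3, (∀ a : Fin 0, x a ≠ x' a) := fun x x' a => a.elim0
    simp [harrisSlack, h]
  | succ d ih =>
    obtain ⟨ι, hι, c, ω, ω', a, hc, hω, hω', hid⟩ := ih
    -- base levels of the two vertical cut edges: `lev 0 = 0`, `lev 1 = 1`
    let lev : Fin 2 → Fin 3 := fun i => ⟨i, by omega⟩
    let OP : Type := {pq : Q d 3 × Q d 3 // ∀ b, pq.1 b ≠ pq.2 b}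
    refine ⟨(ι × Fin 3) ⊕ (OP × Fin 2 × Fin 2), inferInstance,
      Sum.elim (fun tj => 2 * c tj.1) (fun s => if s.2.1 = s.2.2 then 2 else 1),
      Sum.elim (fun tj => Fin.snoc (ω tj.1) tj.2) (fun s => Fin.snoc s.1.1.1 (lev s.2.1)),
      Sum.elim (fun tj => Fin.snoc (ω' tj.1) tj.2) (fun s => Fin.snoc s.1.1.2 (lev s.2.2)),
      Sum.elim (fun tj => Fin.castSucc (a tj.1)) (fun _ => Fin.last d), ?_, ?_, ?_, fun y z => ?_⟩
    · rintro (⟨t, j⟩ | ⟨pq, i, i'⟩)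
      · simp only [Sum.elim_inl]; exact mul_nonneg zero_le_two (hc t)
      · simp only [Sum.elim_inr]; split_ifs <;> norm_num
    · rintro (⟨t, j⟩ | ⟨pq, i, i'⟩)
      · simp only [Sum.elim_inl, Fin.snoc_castSucc]; exact hω t
      · simp only [Sum.elim_inr, Fin.snoc_last]; show (i : ℕ) + 1 < 3; omega
    · rintro (⟨t, j⟩ | ⟨pq, i, i'⟩)
      · simp only [Sum.elim_inl, Fin.snoc_castSucc]; exact hω' t
      · simp only [Sum.elim_inr, Fin.snoc_last]; show (i' : ℕ) + 1 < 3; omega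
    · -- notation: layer restrictions
      set yj : Fin 3 → Q d 3 → ℝ := fun j p => y (Fin.snoc p j) with hyj
      set zj : Fin 3 → Q d 3 → ℝ := fun j p => z (Fin.snoc p j) with hzj
      -- (L1) the form in dimension d+1, split along the last coordinate
      have hdiag : (∑ x : Q (d + 1) 3, y x * z x) = ∑ j : Fin 3, ∑ p : Q d 3, yj j p * zj j p := sum_cube3_succ _
      have hopp : (∑ x : Q (d + 1) 3, ∑ x', if (∀ b, x b ≠ x' b) then y x * z x' else 0) =
          ∑ p : Q d 3, ∑ q : Q d 3, if (∀ b, p b ≠ q b) then (∑ i : Fin 3, ∑ j : Fin 3, if i ≠ j then yj i p * zj j q else 0) else 0 := by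
        rw [sum_cube3_succ']
        refine Finset.sum_congr rfl fun p _ => ?_
        have hin : ∀ i : Fin 3, (∑ x' : Q (d + 1) 3, if (∀ b, (Fin.snoc p i : Q (d + 1) 3) b ≠ x' b) then y (Fin.snoc p i) * z x' else 0)
            = ∑ q : Q d 3, ∑ j : Fin 3, if ((∀ b, p b ≠ q b) ∧ i ≠ j) then yj i p * zj j q else 0 := by
          intro i
          rw [sum_cube3_succ']
          refine Finset.sum_congr rfl fun q _ => Finset.sum_congr rfl fun j _ => ?_
          simp only [opp_snoc_iff, hyj, hzj]
        simp_rw [hin]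
        rw [Finset.sum_comm]
        refine Finset.sum_congr rfl fun q _ => ?_
        by_cases hpq : (∀ b, p b ≠ q b)
        · rw [if_pos hpq]
          refine Finset.sum_congr rfl fun i _ => Finset.sum_congr rfl fun j _ => ?_
          by_cases hij : i ≠ j
          · rw [if_pos ⟨hpq, hij⟩, if_pos hij]
          · rw [if_neg (fun h => hij h.2), if_neg hij]
        · rw [if_neg hpq]
          refine Finset.sum_eq_zero fun i _ => Finset.sum_eq_zero fun j _ => ?_
          rw [if_neg (fun h => hpq h.1)]
      -- (L2) the three layer copies, by the induction hypothesis
      have hlayer : ∀ j : Fin 3, (∑ t, c t * ((y (bump (Fin.snoc (ω t) j : Q (d + 1) 3) (Fin.castSucc (a t))) - y (Fin.snoc (ω t) j)) *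
            (z (bump (Fin.snoc (ω' t) j : Q (d + 1) 3) (Fin.castSucc (a t))) - z (Fin.snoc (ω' t) j)))) = harrisSlack d (yj j) (zj j) := by
        intro j
        rw [hid]
        refine Finset.sum_congr rfl fun t _ => ?_
        simp only [bump_snoc_castSucc, hyj, hzj]
      -- (L3) the vertical pairs over opposite base points
      have hvert : ∀ (p q : Q d 3), (∑ i : Fin 2, ∑ i' : Fin 2, (if i = i' then (2:ℝ) else 1) *
            ((y (bump (Fin.snoc p (lev i) : Q (d + 1) 3) (Fin.last d)) - y (Fin.snoc p (lev i))) *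
             (z (bump (Fin.snoc q (lev i') : Q (d + 1) 3) (Fin.last d)) - z (Fin.snoc q (lev i'))))) =
            2 * (∑ i : Fin 3, yj i p * zj i q) - (∑ i : Fin 3, ∑ j : Fin 3, if i ≠ j then yj i p * zj j q else 0) := by
        intro p q
        rw [threeI_sub_J_eq]
        simp only [bump_snoc_last, Fin.sum_univ_two, hyj, hzj]
        have l0 : lev 0 = 0 := rfl
        have l1 : lev 1 = 1 := rfl
        have s0 : succ3 0 = 1 := by decide
        have s1 : succ3 1 = 2 := by decide
        simp only [l0, l1, s0, s1, if_true, show ((0:Fin 2) = 1) = False from propext ⟨by decide, False.elim⟩,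
          show ((1:Fin 2) = 0) = False from propext ⟨by decide, False.elim⟩, if_false]
        ring
      -- assemble
      rw [Fintype.sum_sum_type, Fintype.sum_prod_type, Fintype.sum_prod_type]
      simp only [Sum.elim_inl, Sum.elim_inr]
      -- inl part
      have hinl : (∑ t, ∑ j : Fin 3, 2 * c t * ((y (bump (Fin.snoc (ω t) j : Q (d + 1) 3) (Fin.castSucc (a t))) - y (Fin.snoc (ω t) j)) *
            (z (bump (Fin.snoc (ω' t) j : Q (d + 1) 3) (Fin.castSucc (a t))) - z (Fin.snoc (ω' t) j)))) =
            2 * ∑ j : Fin 3, harrisSlack d (yj j) (zj j) := by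
        rw [Finset.sum_comm, Finset.mul_sum]
        refine Finset.sum_congr rfl fun j _ => ?_
        rw [← hlayer j, Finset.mul_sum]
        refine Finset.sum_congr rfl fun t _ => ?_
        ring
      -- inr part
      have hinr : (∑ s : OP, ∑ ii : Fin 2 × Fin 2, (if ii.1 = ii.2 then (2:ℝ) else 1) *
            ((y (bump (Fin.snoc s.1.1 (lev ii.1) : Q (d + 1) 3) (Fin.last d)) - y (Fin.snoc s.1.1 (lev ii.1))) *
             (z (bump (Fin.snoc s.1.2 (lev ii.2) : Q (d + 1) 3) (Fin.last d)) - z (Fin.snoc s.1.2 (lev ii.2))))) =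
            ∑ p : Q d 3, ∑ q : Q d 3, if (∀ b, p b ≠ q b) then
              (2 * (∑ i : Fin 3, yj i p * zj i q) - (∑ i : Fin 3, ∑ j : Fin 3, if i ≠ j then yj i p * zj j q else 0)) else 0 := by
        have h1 : ∀ s : OP, (∑ ii : Fin 2 × Fin 2, (if ii.1 = ii.2 then (2:ℝ) else 1) *
            ((y (bump (Fin.snoc s.1.1 (lev ii.1) : Q (d + 1) 3) (Fin.last d)) - y (Fin.snoc s.1.1 (lev ii.1))) *
             (z (bump (Fin.snoc s.1.2 (lev ii.2) : Q (d + 1) 3) (Fin.last d)) - z (Fin.snoc s.1.2 (lev ii.2))))) =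
            2 * (∑ i : Fin 3, yj i s.1.1 * zj i s.1.2) - (∑ i : Fin 3, ∑ j : Fin 3, if i ≠ j then yj i s.1.1 * zj j s.1.2 else 0) := by
          intro s; rw [Fintype.sum_prod_type]; exact hvert s.1.1 s.1.2
        simp_rw [h1]
        -- sum over the subtype of opposite pairs = sum over all pairs with an indicator
        let g : Q d 3 × Q d 3 → ℝ := fun pq =>
          2 * (∑ i : Fin 3, yj i pq.1 * zj i pq.2) - (∑ i : Fin 3, ∑ j : Fin 3, if i ≠ j then yj i pq.1 * zj j pq.2 else 0)
        have hsub : (∑ s : OP, g s.1) = ∑ pq ∈ (univ : Finset (Q d 3 × Q d 3)).filter (fun pq => ∀ b, pq.1 b ≠ pq.2 b), g pq :=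
          (Finset.sum_subtype _ (fun pq => by simp only [Finset.mem_filter, Finset.mem_univ, true_and]) g).symm
        show (∑ s : OP, g s.1) = _
        rw [hsub, Finset.sum_filter, Fintype.sum_prod_type]
      rw [hinl, hinr]
      -- atoms: A = diagonal, S = same-layer opposite, X = cross-layer opposite
      have hLHS : harrisSlack (d + 1) y z = (2:ℝ) ^ (d + 1) * (∑ j : Fin 3, ∑ p : Q d 3, yj j p * zj j p) -
          ∑ p : Q d 3, ∑ q : Q d 3, if (∀ b, p b ≠ q b) then (∑ i : Fin 3, ∑ j : Fin 3, if i ≠ j then yj i p * zj j q else 0) else 0 := by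
        unfold harrisSlack; rw [hdiag, hopp]
      have hlayers : (∑ j : Fin 3, harrisSlack d (yj j) (zj j)) = (2:ℝ) ^ d * (∑ j : Fin 3, ∑ p : Q d 3, yj j p * zj j p) -
          ∑ j : Fin 3, ∑ p : Q d 3, ∑ q : Q d 3, if (∀ b, p b ≠ q b) then yj j p * zj j q else 0 := by
        unfold harrisSlack; rw [Finset.sum_sub_distrib, Finset.mul_sum]
      have hS : (∑ j : Fin 3, ∑ p : Q d 3, ∑ q : Q d 3, if (∀ b, p b ≠ q b) then yj j p * zj j q else 0) =
          ∑ p : Q d 3, ∑ q : Q d 3, if (∀ b, p b ≠ q b) then (∑ i : Fin 3, yj i p * zj i q) else 0 := by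
        rw [Finset.sum_comm]
        refine Finset.sum_congr rfl fun p _ => ?_
        rw [Finset.sum_comm]
        refine Finset.sum_congr rfl fun q _ => ?_
        by_cases hpq : (∀ b, p b ≠ q b)
        · simp only [if_pos hpq]
        · simp only [if_neg hpq, Finset.sum_const_zero]
      have hT : (∑ p : Q d 3, ∑ q : Q d 3, if (∀ b, p b ≠ q b) then
              (2 * (∑ i : Fin 3, yj i p * zj i q) - (∑ i : Fin 3, ∑ j : Fin 3, if i ≠ j then yj i p * zj j q else 0)) else 0) =
          2 * (∑ p : Q d 3, ∑ q : Q d 3, if (∀ b, p b ≠ q b) then (∑ i : Fin 3, yj i p * zj i q) else 0) -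
          ∑ p : Q d 3, ∑ q : Q d 3, if (∀ b, p b ≠ q b) then (∑ i : Fin 3, ∑ j : Fin 3, if i ≠ j then yj i p * zj j q else 0) else 0 := by
        rw [Finset.mul_sum, ← Finset.sum_sub_distrib]
        refine Finset.sum_congr rfl fun p _ => ?_
        rw [Finset.mul_sum, ← Finset.sum_sub_distrib]
        refine Finset.sum_congr rfl fun q _ => ?_
        split_ifs <;> ring
      rw [hLHS, hlayers, hT, hS, pow_succ]
      ring

/-- **The same certificate with the tree's literals** (`SahiSlot.Lit d 3`): the Harris slack on `[3]^d` is a nonnegative combination of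
products `ℓ(y)·ℓ'(z)` of cut-edge literals, in every dimension. [this work] -/
theorem harrisSlack_eq_sum_litPairs (d : ℕ) :
    ∃ (k : ℕ) (c : Fin k → ℝ) (J J' : Fin k → Lit d 3), (∀ t, 0 ≤ c t) ∧
      ∀ y z : Q d 3 → ℝ, harrisSlack d y z = ∑ t, c t * ((J t).eval y * (J' t).eval z) := by
  obtain ⟨ι, hι, c, ω, ω', a, hc, hω, hω', hid⟩ := harrisSlack_eq_sum_coverPairs d
  classical
  let e : ι ≃ Fin (Fintype.card ι) := Fintype.equivFin ι
  refine ⟨Fintype.card ι, fun t => c (e.symm t), fun t => Lit.cover (ω (e.symm t)) (a (e.symm t)),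
    fun t => Lit.cover (ω' (e.symm t)) (a (e.symm t)), fun t => hc _, fun y z => ?_⟩
  rw [hid y z, ← e.symm.sum_comp]
  refine Fintype.sum_congr _ _ fun t => ?_
  rw [Lit.eval_cover_eq_bump _ _ (hω _), Lit.eval_cover_eq_bump _ _ (hω' _)]

/-- Consequence on up-sets (re-deriving the sign of prim-sahi's `H_d`, here from the certificate): for up-sets `X, V ⊆ [3]^d`,
`harrisSlack d 1_X 1_V ≥ 0`. [this work] -/
theorem harrisSlack_setInd_nonneg (X V : Finset (Q d 3)) (hX : IsUpperSet ((X : Finset (Q d 3)) : Set (Q d 3)))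
    (hV : IsUpperSet ((V : Finset (Q d 3)) : Set (Q d 3))) :
    0 ≤ harrisSlack d (Literature.Combinatorics.Sahi2008.setInd X) (Literature.Combinatorics.Sahi2008.setInd V) := by
  obtain ⟨k, c, J, J', hc, hid⟩ := harrisSlack_eq_sum_litPairs d
  rw [hid]
  exact sum_nonneg fun t _ => mul_nonneg (hc t) (mul_nonneg (Lit.eval_setInd_nonneg _ hX _) (Lit.eval_setInd_nonneg _ hV _))

end HarrisSlack

end SahiSlot

end Summit.CriticalPhenomena.PercolationContinuityZ3.Theorems
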